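import Summits.Ventures.PercRepro.S1PlaneCounts
import Summits.Ventures.PercRepro.S1JointYSide

/-!
# PercRepro — S1 LEMMA B, `μ(8) ≥ 48`: an eight-point rank-`4` flat has at most `8` low five-subsets (p2, gen 16;
SUBCLAIM-S1 §4 (A13))

`S1PlaneCounts.five_mul_choose_le_ncard_rank4Five` charges a rank-`4` flat `F` with `|F| = 8` by `μ(8) ≥ 28`
(`5·56 ≤ 5μ + 2·70`). Exactly: the five-subsets of `F` of rank `≤ 3` are the five-subsets of the planes `P ⊆ F`
with `≥ 5` points (`exists_planes`), and

* THE PAIR LEMMA — for `a ≠ b` in `F` at most `2` five-point planes of `F` contain both: with `ℓ := cl{a, b}`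
  (`2 ≤ |ℓ| ≤ 3`, `ℓ ⊆ P` for every such plane) the sets `P ∖ ℓ` are pairwise disjoint (a common point `z ∉ ℓ` makes
  `{a, b, z}` of rank `3` span both planes) of size `5 − |ℓ|` inside `F ∖ ℓ` of size `8 − |ℓ|`;
* if `F` has a six-point plane `P₀`, every other plane has `5` points and contains the two points of `F ∖ P₀`
  (`|P ∩ P₀| ≤ 3`), so there are at most `2` of them: `6 + 2 = 8`;
* otherwise every plane has `5` points; each plane other than a fixed `P₁` contains two of the three points of
  `F ∖ P₁`, and each of the `3` pairs lies in at most `2` planes: `1 + 6 = 7`.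

* **`ncard_planes_through_pair_le_two`** — the pair lemma; **`sum_choose_five_le_eight`** — `Σ_P C(|P|, 5) ≤ 8`;
* **`fortyeight_le_ncard_rank4Five_of_eight`** — `μ(8) ≥ 48`.
Axioms: standard.
-/

open scoped Matroid

namespace PercRepro

namespace S1

open Set

variable {α : Type}

/-- **THE PAIR LEMMA**: in a rank-`4` flat `F` with `8` points, at most two five-point planes `P ⊆ F` (closed,
rank `3`) contain two given distinct points `a, b ∈ F`. -/
theorem ncard_planes_through_pair_le_two (M : Matroid α) [M.Finite]
    (hcirc : ∀ C, M.IsCircuit C → 3 ≤ C.encard)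
    (hline : ∀ L ⊆ M.E, M.eRk L ≤ 2 → L.ncard ≤ 3)
    {F : Set α} (hF : F ⊆ M.E) (hcl : M.closure F = F) (h8 : F.ncard = 8)
    (PL : Finset (Set α)) (hPL : ∀ P ∈ PL, P ⊆ F ∧ M.eRk P = 3 ∧ M.closure P = P)
    (a b : α) (ha : a ∈ F) (hb : b ∈ F) (hab : a ≠ b) (fam : Finset (Set α))
    (hmem : ∀ P ∈ fam, P ∈ PL ∧ P.ncard = 5 ∧ a ∈ P ∧ b ∈ P) : fam.card ≤ 2 := by
  classical
  have hFfin : F.Finite := M.ground_finite.subset hF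
  -- the line `ℓ = cl{a, b}`
  set ℓ := M.closure {a, b} with hℓ
  have hab2 : M.eRk {a, b} = 2 := eRk_pair_eq_two_of_hcirc M hcirc (hF ha) (hF hb) hab
  have hℓr : M.eRk ℓ = 2 := by rw [hℓ, M.eRk_closure_eq]; exact hab2
  have hℓE : ℓ ⊆ M.E := M.closure_subset_ground _
  have hℓF : ℓ ⊆ F := by
    rw [hℓ, ← hcl]; exact M.closure_subset_closure (pair_subset ha hb)
  have hℓ3 : ℓ.ncard ≤ 3 := hline ℓ hℓE hℓr.le
  have hℓ2 : 2 ≤ ℓ.ncard := by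
    rw [← ncard_pair hab]
    exact Set.ncard_le_ncard (M.subset_closure {a, b} (pair_subset (hF ha) (hF hb))) (hFfin.subset hℓF)
  have hℓfin : ℓ.Finite := hFfin.subset hℓF
  -- every plane of the family contains `ℓ`
  have hℓP : ∀ P ∈ fam, ℓ ⊆ P := by
    intro P hP
    obtain ⟨hP', -, haP, hbP⟩ := hmem P hP
    rw [hℓ, ← (hPL P hP').2.2]
    exact M.closure_subset_closure (pair_subset haP hbP)
  -- `P ∖ ℓ`, as a finset
  set comp : Set α → Finset α := fun P => hFfin.toFinset.filter (fun x => x ∈ P ∧ x ∉ ℓ) with hcomp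
  have hcomp_coe : ∀ P ∈ fam, ((comp P : Finset α) : Set α) = P \ ℓ := by
    intro P hP
    obtain ⟨hP', -, -, -⟩ := hmem P hP
    ext x
    rw [hcomp]
    simp only [Finset.coe_filter, Set.Finite.mem_toFinset, Set.mem_setOf_eq, Set.mem_sdiff]
    constructor
    · exact fun h => h.2
    · exact fun h => ⟨(hPL P hP').1 h.1, h⟩
  have hcomp_card : ∀ P ∈ fam, (comp P).card = 5 - ℓ.ncard := by
    intro P hP
    obtain ⟨hP', h5, -, -⟩ := hmem P hP
    rw [← Set.ncard_coe_finset, hcomp_coe P hP, Set.ncard_sdiff' (hℓP P hP) (hFfin.subset (hPL P hP').1), h5]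
  -- two distinct planes of the family have disjoint complements of `ℓ`
  have hdisj : (fam : Set (Set α)).PairwiseDisjoint comp := by
    intro P hP P' hP' hne
    rw [Function.onFun, Finset.disjoint_left]
    intro z hz hz'
    have hzP : z ∈ P \ ℓ := by rw [← hcomp_coe P hP]; exact hz
    have hzP' : z ∈ P' \ ℓ := by rw [← hcomp_coe P' hP']; exact hz'
    obtain ⟨hPm, -, haP, hbP⟩ := hmem P hP
    obtain ⟨hPm', -, haP', hbP'⟩ := hmem P' hP'
    have hzE : z ∈ M.E := hF ((hPL P hPm).1 hzP.1)
    -- `{a, b, z}` has rank `3`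
    have hr3 : M.eRk (insert z {a, b}) = 3 := by
      rw [M.eRk_insert_eq_add_one ⟨hzE, hzP.2⟩, hab2]; norm_num
    have hfin3 : (insert z {a, b} : Set α).Finite := (Set.finite_singleton z).insert a |>.insert b |> fun _ =>
      Set.toFinite _
    have hsub : insert z {a, b} ⊆ P := insert_subset hzP.1 (pair_subset haP hbP)
    have hsub' : insert z {a, b} ⊆ P' := insert_subset hzP'.1 (pair_subset haP' hbP')
    have h1 : M.closure (insert z {a, b}) = M.closure P :=
      closure_eq_closure_of_subset_of_eRk_le M hfin3 hsub (by rw [(hPL P hPm).2.1, hr3])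
    have h2 : M.closure (insert z {a, b}) = M.closure P' :=
      closure_eq_closure_of_subset_of_eRk_le M hfin3 hsub' (by rw [(hPL P' hPm').2.1, hr3])
    exact hne (by rw [← (hPL P hPm).2.2, ← h1, h2, (hPL P' hPm').2.2])
  -- the complements lie in `F ∖ ℓ`
  have hunion : fam.biUnion comp ⊆ hFfin.toFinset.filter (fun x => x ∉ ℓ) := by
    intro x hx
    rw [Finset.mem_biUnion] at hx
    obtain ⟨P, hP, hxP⟩ := hx
    have : x ∈ P \ ℓ := by rw [← hcomp_coe P hP]; exact hxP
    obtain ⟨hPm, -, -, -⟩ := hmem P hP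
    rw [Finset.mem_filter, Set.Finite.mem_toFinset]
    exact ⟨(hPL P hPm).1 this.1, this.2⟩
  have hFℓ : (hFfin.toFinset.filter (fun x => x ∉ ℓ)).card = 8 - ℓ.ncard := by
    have hcoe : ((hFfin.toFinset.filter (fun x => x ∉ ℓ) : Finset α) : Set α) = F \ ℓ := by
      ext x
      simp only [Finset.coe_filter, Set.Finite.mem_toFinset, Set.mem_setOf_eq, Set.mem_sdiff]
    rw [← Set.ncard_coe_finset, hcoe, Set.ncard_sdiff' hℓF hFfin, h8]
  have hcount : fam.card * (5 - ℓ.ncard) ≤ 8 - ℓ.ncard := by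
    calc fam.card * (5 - ℓ.ncard) = ∑ P ∈ fam, (comp P).card := by
          rw [Finset.sum_congr rfl hcomp_card, Finset.sum_const, smul_eq_mul]
      _ = (fam.biUnion comp).card := (Finset.card_biUnion hdisj).symm
      _ ≤ (hFfin.toFinset.filter (fun x => x ∉ ℓ)).card := Finset.card_le_card hunion
      _ = 8 - ℓ.ncard := hFℓ
  have hℓcases : ℓ.ncard = 2 ∨ ℓ.ncard = 3 := by omega
  rcases hℓcases with h | h
  · rw [h] at hcount; omega
  · rw [h] at hcount; omega

/-- **THE PLANES OF AN EIGHT-POINT RANK-`4` FLAT CARRY AT MOST `8` LOW FIVE-SETS**: for the planes `PL` of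
`exists_planes`, `Σ_{P ∈ PL} C(|P|, 5) ≤ 8`. -/
theorem sum_choose_five_le_eight (M : Matroid α) [M.Finite]
    (hcirc : ∀ C, M.IsCircuit C → 3 ≤ C.encard)
    (hline : ∀ L ⊆ M.E, M.eRk L ≤ 2 → L.ncard ≤ 3)
    {F : Set α} (hF : F ⊆ M.E) (hcl : M.closure F = F) (h8 : F.ncard = 8)
    (PL : Finset (Set α))
    (hplaneP : ∀ P ∈ PL, P ⊆ F ∧ M.eRk P = 3 ∧ M.closure P = P ∧ 5 ≤ P.ncard ∧ P.ncard ≤ 6)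
    (hinter : ∀ P ∈ PL, ∀ P' ∈ PL, P ≠ P' → (P ∩ P').ncard ≤ 3) :
    ∑ P ∈ PL, P.ncard.choose 5 ≤ 8 := by
  classical
  have hFfin : F.Finite := M.ground_finite.subset hF
  have hPL : ∀ P ∈ PL, P ⊆ F ∧ M.eRk P = 3 ∧ M.closure P = P := fun P hP =>
    ⟨(hplaneP P hP).1, (hplaneP P hP).2.1, (hplaneP P hP).2.2.1⟩
  have hpair := ncard_planes_through_pair_le_two M hcirc hline hF hcl h8 PL hPL
  -- two distinct planes: `|P ∪ P'| ≥ |P| + |P'| − 3`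
  have hunion : ∀ P ∈ PL, ∀ P' ∈ PL, P ≠ P' → P.ncard + P'.ncard ≤ 11 := by
    intro P hP P' hP' hne
    have h := Set.ncard_union_add_ncard_inter P P' (hFfin.subset (hplaneP P hP).1)
      (hFfin.subset (hplaneP P' hP').1)
    have h1 := hinter P hP P' hP' hne
    have h2 : (P ∪ P').ncard ≤ F.ncard :=
      Set.ncard_le_ncard (union_subset (hplaneP P hP).1 (hplaneP P' hP').1) hFfin
    omega
  by_cases hsix : ∃ P₀ ∈ PL, P₀.ncard = 6
  · -- CASE 1: a six-point plane `P₀`; the others have five points and contain `F ∖ P₀ = {a, b}`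
    obtain ⟨P₀, hP₀, hP₀6⟩ := hsix
    have hcompl : (F \ P₀).ncard = 2 := by
      rw [Set.ncard_sdiff' (hplaneP P₀ hP₀).1 hFfin, h8, hP₀6]
    obtain ⟨a, b, hab, hFP₀⟩ := Set.ncard_eq_two.1 hcompl
    have ha : a ∈ F := by
      have : a ∈ F \ P₀ := by rw [hFP₀]; exact mem_insert a {b}
      exact this.1
    have hb : b ∈ F := by
      have : b ∈ F \ P₀ := by rw [hFP₀]; exact mem_insert_of_mem a rfl
      exact this.1
    have hrest : ∀ P ∈ PL.erase P₀, P.ncard = 5 ∧ a ∈ P ∧ b ∈ P := by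
      intro P hP
      rw [Finset.mem_erase] at hP
      obtain ⟨hne, hPm⟩ := hP
      have h5 : P.ncard = 5 := by
        have := hunion P hPm P₀ hP₀ hne
        have := (hplaneP P hPm).2.2.2.1
        omega
      -- `P ∖ P₀ = F ∖ P₀`
      have hsub : P \ P₀ ⊆ F \ P₀ := Set.sdiff_subset_sdiff_left (hplaneP P hPm).1
      have hcard : (F \ P₀).ncard ≤ (P \ P₀).ncard := by
        have h := Set.ncard_union_add_ncard_inter P P₀ (hFfin.subset (hplaneP P hPm).1)
          (hFfin.subset (hplaneP P₀ hP₀).1)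
        have h1 := hinter P hPm P₀ hP₀ hne
        have h2 := Set.ncard_inter_add_ncard_sdiff_eq_ncard P P₀ (hFfin.subset (hplaneP P hPm).1)
        omega
      have heq : P \ P₀ = F \ P₀ := Set.eq_of_subset_of_ncard_le hsub hcard (hFfin.subset sdiff_subset)
      refine ⟨h5, ?_, ?_⟩
      · have : a ∈ P \ P₀ := by rw [heq, hFP₀]; exact mem_insert a {b}
        exact this.1
      · have : b ∈ P \ P₀ := by rw [heq, hFP₀]; exact mem_insert_of_mem a rfl
        exact this.1
    have hle2 : (PL.erase P₀).card ≤ 2 :=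
      hpair a b ha hb hab (PL.erase P₀) (fun P hP => ⟨Finset.mem_of_mem_erase hP, hrest P hP⟩)
    rw [← Finset.sum_erase_add PL _ hP₀, hP₀6]
    have hsum : ∑ P ∈ PL.erase P₀, P.ncard.choose 5 = (PL.erase P₀).card := by
      rw [Finset.card_eq_sum_ones]
      apply Finset.sum_congr rfl
      intro P hP
      rw [(hrest P hP).1, Nat.choose_self]
    rw [hsum]
    have : Nat.choose 6 5 = 6 := by decide
    omega
  · -- CASE 2: every plane has five points; at most `1 + 3·2` of them
    push Not at hsix
    have hP5 : ∀ P ∈ PL, P.ncard = 5 := by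
      intro P hP
      have := (hplaneP P hP).2.2.2.1
      have := (hplaneP P hP).2.2.2.2
      have := hsix P hP
      omega
    have hsum : ∑ P ∈ PL, P.ncard.choose 5 = PL.card := by
      rw [Finset.card_eq_sum_ones]
      apply Finset.sum_congr rfl
      intro P hP
      rw [hP5 P hP, Nat.choose_self]
    rw [hsum]
    rcases PL.eq_empty_or_nonempty with hemp | ⟨P₁, hP₁⟩
    · rw [hemp, Finset.card_empty]; omega
    -- the three points off `P₁`
    have hTfin : (F \ P₁).Finite := hFfin.subset sdiff_subset
    set T := hTfin.toFinset with hT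
    have hTcard : T.card = 3 := by
      rw [hT, ← Set.ncard_eq_toFinset_card _ hTfin, Set.ncard_sdiff' (hplaneP P₁ hP₁).1 hFfin, h8, hP5 P₁ hP₁]
    -- every other plane contains a two-subset of `F ∖ P₁`
    have hcover : PL.erase P₁ ⊆ (T.powersetCard 2).biUnion
        (fun S => PL.filter (fun P => P.ncard = 5 ∧ (S : Set α) ⊆ P)) := by
      intro P hP
      rw [Finset.mem_erase] at hP
      obtain ⟨hne, hPm⟩ := hP
      have hPfin : (P \ P₁).Finite := hFfin.subset ((hplaneP P hPm).1.trans' sdiff_subset)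
      have h2 : 2 ≤ hPfin.toFinset.card := by
        rw [← Set.ncard_eq_toFinset_card _ hPfin]
        have h := Set.ncard_inter_add_ncard_sdiff_eq_ncard P P₁ (hFfin.subset (hplaneP P hPm).1)
        have h1 := hinter P hPm P₁ hP₁ hne
        have := hP5 P hPm
        omega
      obtain ⟨S, hS, hScard⟩ := Finset.exists_subset_card_eq h2
      rw [Finset.mem_biUnion]
      refine ⟨S, ?_, ?_⟩
      · rw [Finset.mem_powersetCard]
        refine ⟨?_, hScard⟩
        intro x hx
        have := hS hx
        rw [Set.Finite.mem_toFinset] at this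
        rw [hT, Set.Finite.mem_toFinset]
        exact ⟨(hplaneP P hPm).1 this.1, this.2⟩
      · rw [Finset.mem_filter]
        refine ⟨hPm, hP5 P hPm, ?_⟩
        intro x hx
        have := hS (Finset.mem_coe.1 hx)
        rw [Set.Finite.mem_toFinset] at this
        exact this.1
    have hfib : ∀ S ∈ T.powersetCard 2,
        (PL.filter (fun P => P.ncard = 5 ∧ (S : Set α) ⊆ P)).card ≤ 2 := by
      intro S hS
      rw [Finset.mem_powersetCard] at hS
      obtain ⟨a, b, hab, rfl⟩ := Finset.card_eq_two.1 hS.2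
      have ha : a ∈ F := by
        have := hS.1 (Finset.mem_insert_self a {b})
        rw [hT, Set.Finite.mem_toFinset] at this
        exact this.1
      have hb : b ∈ F := by
        have := hS.1 (Finset.mem_insert_of_mem (Finset.mem_singleton_self b))
        rw [hT, Set.Finite.mem_toFinset] at this
        exact this.1
      refine hpair a b ha hb hab _ ?_
      intro P hP
      rw [Finset.mem_filter] at hP
      obtain ⟨hPm, h5, hSP⟩ := hP
      rw [Finset.coe_pair] at hSP
      exact ⟨hPm, h5, hSP (mem_insert a {b}), hSP (mem_insert_of_mem a rfl)⟩
    have hcount : (PL.erase P₁).card ≤ 6 := by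
      calc (PL.erase P₁).card ≤ ((T.powersetCard 2).biUnion
            (fun S => PL.filter (fun P => P.ncard = 5 ∧ (S : Set α) ⊆ P))).card :=
            Finset.card_le_card hcover
        _ ≤ ∑ S ∈ T.powersetCard 2, (PL.filter (fun P => P.ncard = 5 ∧ (S : Set α) ⊆ P)).card :=
            Finset.card_biUnion_le
        _ ≤ ∑ _S ∈ T.powersetCard 2, 2 := Finset.sum_le_sum hfib
        _ = (T.powersetCard 2).card * 2 := by rw [Finset.sum_const, smul_eq_mul]
        _ = 6 := by rw [Finset.card_powersetCard, hTcard]; decide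
    have := Finset.card_erase_of_mem hP₁
    have := Finset.card_pos.2 ⟨P₁, hP₁⟩
    omega

/-- **LEMMA B — `μ(8) ≥ 48`**: an eight-point rank-`4` flat has at least `48` rank-`4` five-subsets
(`C(8, 5) = 56`, at most `8` low five-sets). -/
theorem fortyeight_le_ncard_rank4Five_of_eight (M : Matroid α) [M.Finite]
    (hcirc : ∀ C, M.IsCircuit C → 3 ≤ C.encard)
    (hline : ∀ L ⊆ M.E, M.eRk L ≤ 2 → L.ncard ≤ 3) (hplane : ∀ P ⊆ M.E, M.eRk P ≤ 3 → P.ncard ≤ 6)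
    {F : Set α} (hF : F ⊆ M.E) (hcl : M.closure F = F) (hr : M.eRk F = 4) (h8 : F.ncard = 8) :
    48 ≤ (rank4Five M F).ncard := by
  classical
  obtain ⟨PL, hplaneP, hinter, hlow⟩ := exists_planes M hline hplane hF hcl
  have hsplit := choose_five_eq_ncard_rank4Five_add M hF hr
  rw [h8] at hsplit
  have h56 : Nat.choose 8 5 = 56 := by decide
  have := sum_choose_five_le_eight M hcirc hline hF hcl h8 PL hplaneP hinter
  omega

end S1

end PercRepro
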